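import Summits.Ventures.Crystal3D.Theorems.StickyWulffConstantGenericWallFloorStackLedgerCross
import Summits.Ventures.Crystal3D.Theorems.StickyWulffConstantCoaxialWallLawLedgerWithDefs
import HarnessLib

/-!
# Restatement programme, GENERIC cone, leaf G1: the stack ledger with PRICED cross-grain pairs AT explicit constants

HONEST FRAMING. Venture `Summits/Ventures/Crystal3D` (cell `crystal3d-full`); helper `--supports` the crux `GenericWallFloor`
(stmt-Ventures-19480, line `WallLedgerG`) and lane T's uniform port of the generic cone (cf-p1 DECISION (lxvii)(2), 2026-08-29:
«restatement programme GO … 19480-p2 = the GENERIC cone»; T-V5 P5 `betaIIIAt_of_coverage`).  Rung credit only (census-free,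
standard axioms); F-C1 not moved; E1 (`ExactOnly`) and the StarPairFar consequences stay BY NAME.

`twoSlabAdhesionWith_stackLedger_cross` is `twoSlabAdhesion_stackLedger_cross` (…GenericWallFloorStackLedgerCross — the leaf under the
six priced `Σ9` one-sided cells `genericWallFloorAtCharge_one_sigma9{,Down}_of_far`) with its conclusion in the explicit-constant currency
`TwoSlabLedgerWith C 10 q` of `…CoaxialWallLawLedgerWithDefs`: ONE constant `C = (240√2π + 4440·42)/2 + 2000 + K`, `K` absolute (twice the
uniform sample-deficit constant of `affineSampleDeficit_upper_unif`, in absolute value), for ALL pairs and data.  The proof body is the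
original verbatim; only the two `affineSampleDeficit_upper` lines are replaced by the uniform bound (recipe (i)–(iii) of the programme).
WHAT THIS IS NOT: no new mathematics; not the stub; F-C1 not moved.
-/

noncomputable section

namespace Summit.Ventures.Crystal3D.Theorems

open Summit.Ventures.Crystal3D Finset
open Literature.MathematicalPhysics.StatisticalMechanics (fccStacking barlowStacking IsHaggSeq contactDeficiency)
open scoped InnerProductSpace

open scoped Classical in
/-- **G1 — the stack ledger with priced cross-grain pairs, explicit constants.**  One absolute `K` such that for every E1-datum,
every pair `(A₁·Λ₀ + t₁, A₂·Λ₀ + t₂)`, steep slots `u₁` (up) / `u₂` (down), far hypotheses `hfar₁`/`hfar₂` and the priced cross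
hypothesis `hcross` (verbatim from `twoSlabAdhesion_stackLedger_cross`):
`TwoSlabLedgerWith ((240√2π + 4440·42)/2 + 2000 + K) 10 (½(√2|⟪A₁u₁,e₃⟫| + √2|⟪A₂u₂,e₃⟫|))`. -/
theorem twoSlabAdhesionWith_stackLedger_cross : ∃ K : ℝ, ∀
    {s₀ : EuclideanSpace ℝ (Fin 3)} (hs₀ : s₀ ∈ fccSlots)
    (hcert : ExactOnly 0 (fccSlots.filter fun w => 0 < ⟪w, s₀⟫_ℝ))
    (hDS : ∀ F₁ F₂ : EuclideanSpace ℝ (Fin 3) ≃ₗᵢ[ℝ] EuclideanSpace ℝ (Fin 3), DoubleStarCoaxialAt F₁ F₂)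
    (hCP : CapPairCoaxial)
    (A₁ : EuclideanSpace ℝ (Fin 3) ≃ₗᵢ[ℝ] EuclideanSpace ℝ (Fin 3)) (t₁ : EuclideanSpace ℝ (Fin 3))
    (A₂ : EuclideanSpace ℝ (Fin 3) ≃ₗᵢ[ℝ] EuclideanSpace ℝ (Fin 3)) (t₂ : EuclideanSpace ℝ (Fin 3))
    {u₁ : EuclideanSpace ℝ (Fin 3)} (hu₁ : u₁ ∈ fccSlots)
    (hsteep₁ : Real.sqrt 2 / 2 ≤ ⟪A₁ u₁, EuclideanSpace.single (2 : Fin 3) (1 : ℝ)⟫_ℝ)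
    {u₂ : EuclideanSpace ℝ (Fin 3)} (hu₂ : u₂ ∈ fccSlots)
    (hsteep₂ : ⟪A₂ u₂, EuclideanSpace.single (2 : Fin 3) (1 : ℝ)⟫_ℝ ≤ -(Real.sqrt 2 / 2))
    (hfar₁ : ∀ stk : List WalkEntry, StackSound (EuclideanSpace.single (2 : Fin 3) (1 : ℝ)) stk →
      StackWF (EuclideanSpace.single (2 : Fin 3) (1 : ℝ)) stk → stk.getLast? = some ⟨A₁, u₁, 0⟩ →
      ∀ e ∈ stk, e.frame '' fccStacking 1 (Real.sqrt (2 / 3)) ≠ A₂ '' fccStacking 1 (Real.sqrt (2 / 3)))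
    (hfar₂ : ∀ stk : List WalkEntry, StackSound (-EuclideanSpace.single (2 : Fin 3) (1 : ℝ)) stk →
      StackWF (-EuclideanSpace.single (2 : Fin 3) (1 : ℝ)) stk → stk.getLast? = some ⟨A₂, u₂, 0⟩ →
      ∀ e ∈ stk, e.frame '' fccStacking 1 (Real.sqrt (2 / 3)) ≠ A₁ '' fccStacking 1 (Real.sqrt (2 / 3)))
    (hcross : ∀ (stk₁ stk₂ : List WalkEntry) (e₁ e₂ : WalkEntry) (rest₁ rest₂ : List WalkEntry),
      StackSound (EuclideanSpace.single (2 : Fin 3) (1 : ℝ)) stk₁ → StackWF (EuclideanSpace.single (2 : Fin 3) (1 : ℝ)) stk₁ →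
      stk₁.getLast? = some ⟨A₁, u₁, 0⟩ → stk₁ = e₁ :: rest₁ →
      StackSound (-EuclideanSpace.single (2 : Fin 3) (1 : ℝ)) stk₂ → StackWF (-EuclideanSpace.single (2 : Fin 3) (1 : ℝ)) stk₂ →
      stk₂.getLast? = some ⟨A₂, u₂, 0⟩ → stk₂ = e₂ :: rest₂ →
      (¬ ∃ (L : EuclideanSpace ℝ (Fin 3) ≃ₗᵢ[ℝ] EuclideanSpace ℝ (Fin 3))
          (s₁ s₂ : EuclideanSpace ℝ (Fin 3)) (σ σ' : ℤ → ℤ), IsHaggSeq σ ∧ IsHaggSeq σ' ∧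
          e₁.frame '' fccStacking 1 (Real.sqrt (2 / 3)) ⊆ (fun p => L p + s₁) '' barlowStacking 1 (Real.sqrt (2 / 3)) σ ∧
          e₂.frame '' fccStacking 1 (Real.sqrt (2 / 3)) ⊆ (fun p => L p + s₂) '' barlowStacking 1 (Real.sqrt (2 / 3)) σ') ∨
      ∀ (Y : Finset (EuclideanSpace ℝ (Fin 3))), (∀ p ∈ Y, ∀ q ∈ Y, p ≠ q → 1 ≤ dist p q) → ∀ y ∈ Y,
        (∀ w ∈ fccSlots, ⟪w, e₁.dir⟫_ℝ < 0 → y + e₁.frame w ∈ Y) → (∀ w ∈ fccSlots, ⟪w, e₂.dir⟫_ℝ < 0 → y + e₂.frame w ∈ Y) →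
        starSet y e₁.frame e₁.dir ≠ starSet y e₂.frame e₂.dir ∧
          ∀ q ∈ Y, dist y q = 1 → q ∈ starSet y e₁.frame e₁.dir ∪ starSet y e₂.frame e₂.dir),
    TwoSlabLedgerWith ((240 * Real.sqrt 2 * Real.pi + 4440 * (4 * 10 + 2)) / 2 + 2000 + K) 10
      ((Real.sqrt 2 * |⟪A₁ u₁, EuclideanSpace.single (2 : Fin 3) (1 : ℝ)⟫_ℝ| +
        Real.sqrt 2 * |⟪A₂ u₂, EuclideanSpace.single (2 : Fin 3) (1 : ℝ)⟫_ℝ|) / 2) A₁ t₁ A₂ t₂ := by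
  obtain ⟨Cu, hCu⟩ := affineSampleDeficit_upper_unif
  refine ⟨|Cu * (1 + 10)| + |Cu * (1 + 10)|, ?_⟩
  intro s₀ hs₀ hcert hDS hCP A₁ t₁ A₂ t₂ u₁ hu₁ hsteep₁ u₂ hu₂ hsteep₂ hfar₁ hfar₂ hcross
  set C₁ : ℝ := Cu * (1 + 10) with hC₁def
  have hC₁ := hCu A₁ t₁ 10 (by norm_num)
  have hC₂ := hCu A₂ t₂ 10 (by norm_num)
  intro h hh ρ hρ X P₁ P₂ hX hP₁X hP₂X hcell hP₁ hP₂
  set e₃ : EuclideanSpace ℝ (Fin 3) := EuclideanSpace.single (2 : Fin 3) (1 : ℝ) with he₃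
  have he₃n : ‖e₃‖ = 1 := by rw [he₃, PiLp.norm_single, norm_one]
  have hme₃n : ‖-e₃‖ = 1 := by rw [norm_neg, he₃n]
  have he₃i : ∀ d : EuclideanSpace ℝ (Fin 3), ⟪d, e₃⟫_ℝ = d 2 := fun d => by rw [he₃, EuclideanSpace.inner_single_right]; simp
  have hsteep₂' : Real.sqrt 2 / 2 ≤ ⟪A₂ u₂, -e₃⟫_ℝ := by rw [inner_neg_right]; linarith only [hsteep₂]
  have hA₁far : A₁ '' fccStacking 1 (Real.sqrt (2 / 3)) ≠ A₂ '' fccStacking 1 (Real.sqrt (2 / 3)) :=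
    hfar₁ [⟨A₁, u₁, 0⟩] ⟨hu₁, hsteep₁⟩ rfl rfl ⟨A₁, u₁, 0⟩ (List.mem_singleton_self _)
  set φ₁ : ℝ := Real.sqrt 2 / 4 * ∑ᶠ w ∈ {w ∈ fccStacking 1 (Real.sqrt (2 / 3)) | ‖w‖ = 1},
      |⟪w, A₁.symm (EuclideanSpace.single (2 : Fin 3) (1 : ℝ))⟫_ℝ| with hφ₁
  set φ₂ : ℝ := Real.sqrt 2 / 4 * ∑ᶠ w ∈ {w ∈ fccStacking 1 (Real.sqrt (2 / 3)) | ‖w‖ = 1},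
      |⟪w, A₂.symm (EuclideanSpace.single (2 : Fin 3) (1 : ℝ))⟫_ℝ| with hφ₂
  have hP₂X' : P₂ ⊆ X := hP₂X.trans Finset.sdiff_subset
  obtain ⟨hρ0, hρ1⟩ : (0 : ℝ) ≤ ρ ∧ (1 : ℝ) ≤ ρ := ⟨by linarith, by linarith⟩
  set L : ℝ := 8 / 3 * (h + 4 * 10) with hL; have hL0 : 0 ≤ L := by rw [hL]; positivity
  set N : ℕ := ⌈3 * (h + 4 * 10 + 1)⌉₊ with hNdef
  set ρs : ℝ := ρ - 3 - 8 / 3 * (h + 4 * 10) with hρs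
  set deg : EuclideanSpace ℝ (Fin 3) → ℕ := fun x => (X.filter fun q => dist x q = 1).card with hdeg
  have hdeg12 : ∀ x, deg x ≤ 12 := fun x => card_filter_dist_eq_one_le_twelve X hX x
  set PAY := X.filter fun y => (X.filter fun q => dist y q = 1).card ≠ 12 ∧
    -10 - 2 ≤ y 2 ∧ y 2 ≤ h + 10 + 2 with hPAY
  have hled := ledger_ge_faces_add_interior_credits A₁ t₁ A₂ t₂ X P₁ P₂ 10 h ρ le_rfl hh hρ hX hcell hP₁X hP₂X'
    hP₁ hP₂
  rw [← finsum_unit_fcc_symm_eq_sum_slots A₁, ← finsum_unit_fcc_symm_eq_sum_slots A₂, ← hφ₁, ← hφ₂, ← hPAY] at hled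
  have hN : (3 : ℝ) * (h + 4 * 10 + 1) ≤ (N : ℝ) := by rw [hNdef]; exact Nat.le_ceil _
  set κ₁ : ℝ := Real.sqrt 2 * |⟪A₁ u₁, e₃⟫_ℝ| with hκ₁
  set κ₂ : ℝ := Real.sqrt 2 * |⟪A₂ u₂, e₃⟫_ℝ| with hκ₂
  have hsq : 0 ≤ Real.sqrt 2 := Real.sqrt_nonneg 2; have hπ : Real.pi ≤ 4 := Real.pi_le_four; have hπ0 : 0 ≤ Real.pi := Real.pi_pos.le
  have hs2' : Real.sqrt 2 ≤ 2 := by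
    rw [show (2 : ℝ) = Real.sqrt (2 ^ 2) by rw [Real.sqrt_sq (by norm_num)]]; exact Real.sqrt_le_sqrt (by norm_num)
  have hκ₁0 : 0 ≤ κ₁ := mul_nonneg hsq (abs_nonneg _); have hκ₂0 : 0 ≤ κ₂ := mul_nonneg hsq (abs_nonneg _)
  have hκ₁2 : κ₁ ≤ 2 := by
    have := mul_le_mul hs2' (abs_inner_slot_le_one A₁ hu₁) (abs_nonneg _) (by norm_num); linarith
  have hκ₂2 : κ₂ ≤ 2 := by
    have := mul_le_mul hs2' (abs_inner_slot_le_one A₂ hu₂) (abs_nonneg _) (by norm_num); linarith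
  have hA₁₂ : A₁ ≠ A₂ := fun hAA => hA₁far (by rw [hAA])
  have hbb : (⟨A₁, u₁, 0⟩ : WalkEntry) ≠ ⟨A₂, u₂, 0⟩ := fun hb => hA₁₂ (congrArg WalkEntry.frame hb)
  have hmain : (κ₁ + κ₂) * Real.pi * ρ ^ 2 - 2 * 2000 * (1 + h) * ρ ≤
      (∑ y ∈ PAY, ((12 : ℝ) - ((X.filter fun q => dist y q = 1).card : ℝ))) := by
    have hPAY0 : 0 ≤ ∑ y ∈ PAY, ((12 : ℝ) - ((X.filter fun q => dist y q = 1).card : ℝ)) :=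
      Finset.sum_nonneg fun y _ => by
        have h'' : ((X.filter fun q => dist y q = 1).card : ℝ) ≤ 12 := by exact_mod_cast hdeg12 y
        linarith
    by_cases hbig : 11 + L ≤ ρ
    · -- BIG CELL: run the walkers
      have hρs8 : 8 ≤ ρs := by rw [hρs]; linarith
      have hρs0 : 0 ≤ ρs := by linarith only [hρs8]
      have hρs17 : ρs + 16 ≤ ρ - 1 := by rw [hρs]; linarith only [hh, hL, hL0]
      have hρsρ : ρs ≤ ρ - 1 := by linarith only [hρs17]
      have hρs2 : ρs ^ 2 ≤ ρ ^ 2 := by nlinarith only [hρs0, hρsρ]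
      have hρs3 : ρs ^ 2 ≤ (ρ - 1) ^ 2 := by nlinarith only [hρs0, hρsρ]
      set S₁ := P₁.filter fun p => (-19 : ℝ) ≤ p 2 ∧ p 2 ≤ -19 + 8 ∧ p 0 ^ 2 + p 1 ^ 2 ≤ ρs ^ 2 with hS₁def
      set S₂ := P₂.filter fun p => (h + 11) ≤ p 2 ∧ p 2 ≤ (h + 11) + 8 ∧ p 0 ^ 2 + p 1 ^ 2 ≤ ρs ^ 2 with hS₂def
      set T₁ := S₁.filter fun p => p + A₁ u₁ ∉ S₁ with hT₁def
      set T₂ := S₂.filter fun p => p + A₂ u₂ ∉ S₂ with hT₂def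
      set f₁ : EuclideanSpace ℝ (Fin 3) → EuclideanSpace ℝ (Fin 3) × List WalkEntry :=
        fun p => walkRun X e₃ N (p + A₁ u₁, [⟨A₁, u₁, 0⟩]) with hf₁
      set f₂ : EuclideanSpace ℝ (Fin 3) → EuclideanSpace ℝ (Fin 3) × List WalkEntry :=
        fun p => walkRun X (-e₃) N (p + A₂ u₂, [⟨A₂, u₂, 0⟩]) with hf₂
      have hS₁mem : ∀ p, p ∈ S₁ ↔ (p ∈ P₁ ∧ (-19 : ℝ) ≤ p 2 ∧ p 2 ≤ -19 + 8 ∧ p 0 ^ 2 + p 1 ^ 2 ≤ ρs ^ 2) :=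
        fun p => by rw [hS₁def, Finset.mem_filter]
      have hS₂mem : ∀ p, p ∈ S₂ ↔ (p ∈ P₂ ∧ (h + 11) ≤ p 2 ∧ p 2 ≤ (h + 11) + 8 ∧ p 0 ^ 2 + p 1 ^ 2 ≤ ρs ^ 2) :=
        fun p => by rw [hS₂def, Finset.mem_filter]
      have hS₁ : ∀ p, p ∈ S₁ ↔ (p ∈ (fun q => A₁ q + t₁) '' fccStacking 1 (Real.sqrt (2 / 3)) ∧
          (-19 : ℝ) ≤ p 2 ∧ p 2 ≤ -19 + 8 ∧ p 0 ^ 2 + p 1 ^ 2 ≤ ρs ^ 2) := by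
        intro p; rw [hS₁def, Finset.mem_filter, hP₁]; constructor
        · rintro ⟨⟨hΛ, -, -, -⟩, h1, h2, h3⟩; exact ⟨hΛ, by linarith only [h1], by linarith only [h2], h3⟩
        · rintro ⟨hΛ, h1, h2, h3⟩; exact ⟨⟨hΛ, by linarith only [h1], by linarith only [h2], by linarith only [h3, hρs2]⟩, h1, h2, h3⟩
      have hS₂ : ∀ p, p ∈ S₂ ↔ (p ∈ (fun q => A₂ q + t₂) '' fccStacking 1 (Real.sqrt (2 / 3)) ∧
          (h + 11) ≤ p 2 ∧ p 2 ≤ (h + 11) + 8 ∧ p 0 ^ 2 + p 1 ^ 2 ≤ ρs ^ 2) := by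
        intro p; rw [hS₂def, Finset.mem_filter, hP₂]; constructor
        · rintro ⟨⟨hΛ, -, -, -⟩, h1, h2, h3⟩; exact ⟨hΛ, by linarith only [h1], by linarith only [h2], h3⟩
        · rintro ⟨hΛ, h1, h2, h3⟩; exact ⟨⟨hΛ, by linarith only [h1, hh], by linarith only [h2], by linarith only [h3, hρs2]⟩, h1, h2, h3⟩
      obtain ⟨Ea, Eb, hEa, hEb, hdet, hframe, -⟩ := exists_frame_of_mem_fccSlots hu₁
      have hT₁ := tops_ge_lineCount A₁ t₁ (-19) 8 ρs (by norm_num) hρs8 S₁ hS₁ Ea Eb u₁ hEa hEb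
        (norm_eq_one_of_mem_fccSlots hu₁) hdet hframe
      obtain ⟨Ea', Eb', hEa', hEb', hdet', hframe', -⟩ := exists_frame_of_mem_fccSlots hu₂
      have hT₂ := tops_ge_lineCount A₂ t₂ (h + 11) 8 ρs (by norm_num) hρs8 S₂ hS₂ Ea' Eb' u₂ hEa' hEb'
        (norm_eq_one_of_mem_fccSlots hu₂) hdet' hframe'
      have hT₁' : κ₁ * Real.pi * ρs ^ 2 - 10 * Real.sqrt 2 * Real.pi * ρs ≤ (T₁.card : ℝ) := by rw [hT₁def]; exact hT₁
      have hT₂' : κ₂ * Real.pi * ρs ^ 2 - 10 * Real.sqrt 2 * Real.pi * ρs ≤ (T₂.card : ℝ) := by rw [hT₂def]; exact hT₂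
      have hflux : ∀ κ : ℝ, 0 ≤ κ → κ ≤ 2 → κ * Real.pi * ρ ^ 2 - 2000 * (1 + h) * ρ ≤ κ * Real.pi * ρs ^ 2 - 10 * Real.sqrt 2 * Real.pi * ρs :=
        fun κ hκ0 hκ2 => flux_loss_inner_disc hκ0 hκ2 hh hρ0 (by rw [hρs]) hρs0 hρsρ
      have hT₁'' : κ₁ * Real.pi * ρ ^ 2 - 2000 * (1 + h) * ρ ≤ (T₁.card : ℝ) := le_trans (hflux κ₁ hκ₁0 hκ₁2) hT₁'
      have hT₂'' : κ₂ * Real.pi * ρ ^ 2 - 2000 * (1 + h) * ρ ≤ (T₂.card : ℝ) := le_trans (hflux κ₂ hκ₂0 hκ₂2) hT₂'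
      have hlat_of : ∀ (y₀ y : EuclideanSpace ℝ (Fin 3)) (p : EuclideanSpace ℝ (Fin 3)) (v : EuclideanSpace ℝ (Fin 3)),
          y₀ = p + v → ‖v‖ = 1 → p 0 ^ 2 + p 1 ^ 2 ≤ ρs ^ 2 → ‖y - y₀‖ ≤ L → y 0 ^ 2 + y 1 ^ 2 ≤ (ρ - 2) ^ 2 := by
        intro y₀ y p v hy₀ hv hp3 hd; have h1 := sqrt_lateral_add_le y₀ (y - y₀); rw [add_sub_cancel] at h1
        have h2 := sqrt_lateral_add_le p v; rw [hv, ← hy₀] at h2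
        have h3 : Real.sqrt (p 0 ^ 2 + p 1 ^ 2) ≤ ρs := by rw [← Real.sqrt_sq hρs0]; exact Real.sqrt_le_sqrt hp3
        have h4 : Real.sqrt (y 0 ^ 2 + y 1 ^ 2) ≤ ρ - 2 := by rw [hρs] at h3; linarith only [h1, h2, h3, hd, hL]
        have h7 := pow_le_pow_left₀ (Real.sqrt_nonneg (y 0 ^ 2 + y 1 ^ 2)) h4 2
        rwa [Real.sq_sqrt (by positivity : (0 : ℝ) ≤ y 0 ^ 2 + y 1 ^ 2)] at h7
      have hsq_of_sqrt : ∀ (p : EuclideanSpace ℝ (Fin 3)), Real.sqrt (p 0 ^ 2 + p 1 ^ 2) ≤ ρ - 1 →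
          p 0 ^ 2 + p 1 ^ 2 ≤ (ρ - 1) ^ 2 := by
        intro p hp; have h7 := pow_le_pow_left₀ (Real.sqrt_nonneg (p 0 ^ 2 + p 1 ^ 2)) hp 2
        rwa [Real.sq_sqrt (by positivity : (0 : ℝ) ≤ p 0 ^ 2 + p 1 ^ 2)] at h7
      have hfull₁ : ∀ p ∈ S₁, p ∈ X ∧ ∀ w ∈ fccSlots, p + A₁ w ∈ X := by
        intro p hpS; obtain ⟨hpΛ, hp1, hp2, hp3⟩ := (hS₁ p).1 hpS
        exact ⟨hP₁X ((hS₁mem p).1 hpS).1, fun w hw => hP₁X (inner_sample_full_window A₁ t₁ P₁ (-(2 * 10)) (-10) ρ hρ1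
          hP₁ hpΛ (by linarith only [hp1]) (by linarith only [hp2]) (by linarith only [hp3, hρs3]) hw)⟩
      have hH₁ : ∀ q ∈ X, ⟪q, e₃⟫_ℝ ≤ h + 20 := fun q hq => by rw [he₃i]; linarith only [(hcell q hq).2.1]
      have hend₁ : ∀ t ∈ T₁, (f₁ t).1 ∈ PAY ∧ deg (f₁ t).1 ≤ 11 ∧ WalkInv X e₃ (f₁ t) ∧ StackWF e₃ (f₁ t).2 ∧
          (f₁ t).2.getLast? = some ⟨A₁, u₁, 0⟩ ∧ (∃ e rest, (f₁ t).2 = e :: rest ∧ WalkCertified12 X (f₁ t).1 e) := by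
        intro p hp
        have hpS : p ∈ S₁ := by rw [hT₁def] at hp; exact (Finset.mem_filter.1 hp).1
        obtain ⟨hpΛ, hp1, hp2, hp3⟩ := (hS₁ p).1 hpS
        obtain ⟨hpX, hfull⟩ := hfull₁ p hpS
        have hy0X : p + A₁ u₁ ∈ X := hfull u₁ hu₁
        have hy02 : -20 ≤ (p + A₁ u₁) 2 := by linarith only [(hcell _ hy0X).1]
        have hNh : 8 * (h + 20 - ⟪p + A₁ u₁, e₃⟫_ℝ) < 3 * (N : ℝ) := by rw [he₃i]; linarith only [hN, hy02, hh]
        have hI₀ : WalkInv X e₃ (p + A₁ u₁, [⟨A₁, u₁, 0⟩]) := walkInv_start A₁ hpX hfull hu₁ hsteep₁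
        obtain ⟨hyX, hydeg, hrise, hdisp⟩ := grainWalk_end hX hs₀ hcert he₃n hH₁ A₁ hpX hfull hu₁ hsteep₁ hNh
        have hfw : walkEnd X e₃ N (p + A₁ u₁) [⟨A₁, u₁, 0⟩] = (f₁ p).1 := rfl; have hfw' : walkRun X e₃ N (p + A₁ u₁, [⟨A₁, u₁, 0⟩]) = f₁ p := rfl
        rw [hfw] at hyX hydeg hrise hdisp
        have hy0eq : (p + A₁ u₁) 2 = p 2 + ⟪A₁ u₁, e₃⟫_ℝ := by rw [PiLp.add_apply, ← he₃i (A₁ u₁)]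
        rw [he₃i] at hdisp
        have hlat2 := hlat_of (p + A₁ u₁) (f₁ p).1 p (A₁ u₁) rfl
          (by rw [LinearIsometryEquiv.norm_map, norm_eq_one_of_mem_fccSlots hu₁]) hp3
          (by rw [hL]; linarith only [hdisp, hy02])
        have hvalid := walkRun_valid hX hs₀ hcert he₃n N hI₀ (stackWF_start e₃ A₁ u₁)
        have hlast₁ : (f₁ p).2.getLast? = some ⟨A₁, u₁, 0⟩ := by
          rw [← hfw', walkRun_getLast? hX hs₀ hcert he₃n N _ hI₀]; rfl
        have hfrM := hfar₁ (f₁ p).2 hvalid.1.2.1 hvalid.2 hlast₁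
        have hnothigh := stackWalk_end_not_high_sep hX hs₀ hcert A₂ t₂ P₂ 10 h ρ (by linarith only [hρ]) hP₂X'
          (fun q hq => (hcell q hq).2.1) hP₂ he₃n hH₁ hI₀ hNh
          (fun e' he' => hfrM e' (by rw [← hfw']; exact he')) hlat2
        rw [hfw'] at hnothigh
        have hylat : (f₁ p).1 0 ^ 2 + (f₁ p).1 1 ^ 2 ≤ (ρ - 1) ^ 2 := le_trans hlat2 (by nlinarith only [hρ])
        refine ⟨?_, hydeg, hvalid.1, hvalid.2, hlast₁, ?_⟩
        · rw [hPAY, Finset.mem_filter]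
          refine ⟨hyX, by show deg _ ≠ 12; exact fun h12 => by simp only [hdeg] at h12; omega, ?_, le_of_lt hnothigh⟩
          rw [inner_sub_left, he₃i, he₃i] at hrise
          by_contra hlow; push Not at hlow
          have hsqrt0 : 0 ≤ Real.sqrt 2 / 2 := by positivity
          exact not_unsaturated_in_slab A₁ t₁ (-(2 * 10)) (-10) ρ hρ1 X P₁ hX hP₁X hP₁ hyX
            (by linarith only [hrise, hy0eq, hp1, hsteep₁, hsqrt0]) (by linarith only [hlow]) hylat hydeg
        · rw [← hfw']
          exact walkRun_certified12 hX hs₀ hcert he₃n hI₀ ⟨⟨A₁, u₁, 0⟩, [], rfl, Or.inl ⟨by simpa using hpX,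
            fun w hw => by simp only [add_sub_cancel_right]; exact hfull w hw⟩⟩ N
      have hinj₁ : ∀ t ∈ T₁, ∀ t' ∈ T₁, f₁ t = f₁ t' → t = t' := by
        intro t ht t' ht' hft; rw [hT₁def, Finset.mem_filter] at ht ht'
        refine walkRun_start_injective hX hs₀ hcert he₃n A₁ t₁ hu₁ hsteep₁ S₁ (hlo := -19) (Hd := -11) (ρ' := ρ - 1)
          hρs0 (fun p hp => ?_) (fun p hp => (hfull₁ p hp).2) (fun p hpX hpΛ hlo hhi hlat w hw => ?_)
          (by linarith only [hρs17])
          (sample_interval A₁ t₁ P₁ S₁ hρs0 (by linarith only [hρsρ]) (by norm_num) (by norm_num) hP₁ hS₁mem hu₁)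
          ht.1 ht.2 ht'.1 ht'.2 hft
        · obtain ⟨hpΛ, hp1, hp2, hp3⟩ := (hS₁ p).1 hp
          exact ⟨(hfull₁ p hp).1, hpΛ, by rw [he₃i]; exact hp1, by rw [he₃i]; linarith only [hp2], hp3⟩
        · rw [he₃i] at hlo hhi
          exact hP₁X (inner_sample_full_window A₁ t₁ P₁ (-(2 * 10)) (-10) ρ hρ1 hP₁ hpΛ (by linarith only [hlo])
            (by linarith only [hhi]) (hsq_of_sqrt p hlat) hw)
      have hfull₂ : ∀ p ∈ S₂, p ∈ X ∧ ∀ w ∈ fccSlots, p + A₂ w ∈ X := by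
        intro p hpS; obtain ⟨hpΛ, hp1, hp2, hp3⟩ := (hS₂ p).1 hpS
        exact ⟨hP₂X' ((hS₂mem p).1 hpS).1, fun w hw => hP₂X' (inner_sample_full_window A₂ t₂ P₂ (h + 10) (h + 2 * 10) ρ
          hρ1 hP₂ hpΛ (by linarith only [hp1]) (by linarith only [hp2]) (by linarith only [hp3, hρs3]) hw)⟩
      have hH₂ : ∀ q ∈ X, ⟪q, -e₃⟫_ℝ ≤ 20 := fun q hq => by rw [inner_neg_right, he₃i]; linarith only [(hcell q hq).1]
      have hend₂ : ∀ t ∈ T₂, (f₂ t).1 ∈ PAY ∧ deg (f₂ t).1 ≤ 11 ∧ WalkInv X (-e₃) (f₂ t) ∧ StackWF (-e₃) (f₂ t).2 ∧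
          (f₂ t).2.getLast? = some ⟨A₂, u₂, 0⟩ ∧ (∃ e rest, (f₂ t).2 = e :: rest ∧ WalkCertified12 X (f₂ t).1 e) := by
        intro p hp
        have hpS : p ∈ S₂ := by rw [hT₂def] at hp; exact (Finset.mem_filter.1 hp).1
        obtain ⟨hpΛ, hp1, hp2, hp3⟩ := (hS₂ p).1 hpS
        obtain ⟨hpX, hfull⟩ := hfull₂ p hpS
        have hy0X : p + A₂ u₂ ∈ X := hfull u₂ hu₂
        have hy02 : (p + A₂ u₂) 2 ≤ h + 20 := by linarith only [(hcell _ hy0X).2.1]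
        have hy02' : -20 ≤ (p + A₂ u₂) 2 := by linarith only [(hcell _ hy0X).1]
        have hNh : 8 * (20 - ⟪p + A₂ u₂, -e₃⟫_ℝ) < 3 * (N : ℝ) := by rw [inner_neg_right, he₃i]; linarith only [hN, hy02, hh]
        have hI₀ : WalkInv X (-e₃) (p + A₂ u₂, [⟨A₂, u₂, 0⟩]) := walkInv_start A₂ hpX hfull hu₂ hsteep₂'
        obtain ⟨hyX, hydeg, hrise, hdisp⟩ := grainWalk_end hX hs₀ hcert hme₃n hH₂ A₂ hpX hfull hu₂ hsteep₂' hNh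
        have hfw : walkEnd X (-e₃) N (p + A₂ u₂) [⟨A₂, u₂, 0⟩] = (f₂ p).1 := rfl; have hfw' : walkRun X (-e₃) N (p + A₂ u₂, [⟨A₂, u₂, 0⟩]) = f₂ p := rfl
        rw [hfw] at hyX hydeg hrise hdisp
        have hy0eq : (p + A₂ u₂) 2 = p 2 + ⟪A₂ u₂, e₃⟫_ℝ := by rw [PiLp.add_apply, ← he₃i (A₂ u₂)]
        rw [inner_neg_right, he₃i] at hdisp
        have hlat2 := hlat_of (p + A₂ u₂) (f₂ p).1 p (A₂ u₂) rfl
          (by rw [LinearIsometryEquiv.norm_map, norm_eq_one_of_mem_fccSlots hu₂]) hp3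
          (by rw [hL]; linarith only [hdisp, hy02, hy02', hh])
        have hvalid := walkRun_valid hX hs₀ hcert hme₃n N hI₀ (stackWF_start (-e₃) A₂ u₂)
        have hlast₂ : (f₂ p).2.getLast? = some ⟨A₂, u₂, 0⟩ := by
          rw [← hfw', walkRun_getLast? hX hs₀ hcert hme₃n N _ hI₀]; rfl
        have hfrM := hfar₂ (f₂ p).2 hvalid.1.2.1 hvalid.2 hlast₂
        have hnotlow := stackWalk_end_not_low_sep hX hs₀ hcert A₁ t₁ P₁ 10 ρ (by linarith only [hρ]) hP₁X
          (fun q hq => (hcell q hq).1) hP₁ hme₃n hH₂ hI₀ hNh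
          (fun e' he' => hfrM e' (by rw [← hfw']; exact he')) hlat2
        rw [hfw'] at hnotlow
        have hylat : (f₂ p).1 0 ^ 2 + (f₂ p).1 1 ^ 2 ≤ (ρ - 1) ^ 2 := le_trans hlat2 (by nlinarith only [hρ])
        refine ⟨?_, hydeg, hvalid.1, hvalid.2, hlast₂, ?_⟩
        · rw [hPAY, Finset.mem_filter]
          refine ⟨hyX, by show deg _ ≠ 12; exact fun h12 => by simp only [hdeg] at h12; omega, ?_, ?_⟩
          · have : (-10 : ℝ) - 2 < (f₂ p).1 2 := hnotlow
            linarith only [this]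
          rw [inner_sub_left, inner_neg_right, inner_neg_right, he₃i, he₃i] at hrise
          by_contra hhigh; push Not at hhigh
          have hsqrt0 : 0 ≤ Real.sqrt 2 / 2 := by positivity
          exact not_unsaturated_in_slab A₂ t₂ (h + 10) (h + 2 * 10) ρ hρ1 X P₂ hX hP₂X' hP₂ hyX
            (by linarith only [hhigh]) (by linarith only [hrise, hy0eq, hp2, hsteep₂, hsqrt0]) hylat hydeg
        · rw [← hfw']
          exact walkRun_certified12 hX hs₀ hcert hme₃n hI₀ ⟨⟨A₂, u₂, 0⟩, [], rfl, Or.inl ⟨by simpa using hpX,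
            fun w hw => by simp only [add_sub_cancel_right]; exact hfull w hw⟩⟩ N
      have hinj₂ : ∀ t ∈ T₂, ∀ t' ∈ T₂, f₂ t = f₂ t' → t = t' := by
        intro t ht t' ht' hft; rw [hT₂def, Finset.mem_filter] at ht ht'
        refine walkRun_start_injective hX hs₀ hcert hme₃n A₂ t₂ hu₂ hsteep₂' S₂ (hlo := -(h + 19)) (Hd := -(h + 11))
          (ρ' := ρ - 1) hρs0 (fun p hp => ?_) (fun p hp => (hfull₂ p hp).2) (fun p hpX hpΛ hlo hhi hlat w hw => ?_)
          (by linarith only [hρs17])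
          (sample_interval A₂ t₂ P₂ S₂ hρs0 (by linarith only [hρsρ]) (by linarith only [hh]) (by linarith only [hh])
            hP₂ hS₂mem hu₂)
          ht.1 ht.2 ht'.1 ht'.2 hft
        · obtain ⟨hpΛ, hp1, hp2, hp3⟩ := (hS₂ p).1 hp
          refine ⟨(hfull₂ p hp).1, hpΛ, ?_, ?_, hp3⟩
          · rw [inner_neg_right, he₃i]; linarith only [hp2]
          · rw [inner_neg_right, he₃i]; linarith only [hp1]
        · rw [inner_neg_right, he₃i] at hlo hhi
          exact hP₂X' (inner_sample_full_window A₂ t₂ P₂ (h + 10) (h + 2 * 10) ρ hρ1 hP₂ hpΛ (by linarith only [hhi])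
            (by linarith only [hlo]) (hsq_of_sqrt p hlat) hw)
      have hpt : ∀ y ∈ PAY, deg y + (T₁.filter fun t => (f₁ t).1 = y).card + (T₂.filter fun t => (f₂ t).1 = y).card ≤ 12 := by
        intro y hy; set fib₁ := T₁.filter fun t => (f₁ t).1 = y with hfib₁
        set fib₂ := T₂.filter fun t => (f₂ t).1 = y with hfib₂
        by_cases hemp : fib₁ = ∅ ∧ fib₂ = ∅
        · rw [hemp.1, hemp.2, Finset.card_empty]; have := hdeg12 y; omega
        have hdegy : deg y ≤ 11 := by
          rw [not_and_or] at hemp; rcases hemp with hne | hne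
          · obtain ⟨t, ht⟩ := Finset.nonempty_iff_ne_empty.2 hne
            obtain ⟨htT, hty⟩ := Finset.mem_filter.1 ht; have := (hend₁ t htT).2.1; rw [hty] at this; exact this
          · obtain ⟨t, ht⟩ := Finset.nonempty_iff_ne_empty.2 hne
            obtain ⟨htT, hty⟩ := Finset.mem_filter.1 ht; have := (hend₂ t htT).2.1; rw [hty] at this; exact this
        set ES₁ := fib₁.image f₁ with hES₁
        set ES₂ := fib₂.image f₂ with hES₂
        have hc₁ : ES₁.card = fib₁.card := Finset.card_image_of_injOn fun t ht t' ht' hft =>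
          hinj₁ t (Finset.mem_filter.1 ht).1 t' (Finset.mem_filter.1 ht').1 hft
        have hc₂ : ES₂.card = fib₂.card := Finset.card_image_of_injOn fun t ht t' ht' hft =>
          hinj₂ t (Finset.mem_filter.1 ht).1 t' (Finset.mem_filter.1 ht').1 hft
        have key := card_contacts_add_endStates_le_twelve_cross hX hDS hCP hbb
          (z₁ := e₃) (z₂ := -e₃) hdegy ES₁ ES₂ (fun s hs => ?_) (fun s hs => ?_) (fun s hs s' hs' e rest e' rest' hse hse' => ?_)
        · rw [hc₁, hc₂] at key; exact key
        · obtain ⟨t, ht, rfl⟩ := Finset.mem_image.1 hs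
          obtain ⟨htT, hty⟩ := Finset.mem_filter.1 ht
          obtain ⟨-, -, hI, hW, hlast, hC⟩ := hend₁ t htT
          rw [hty] at hC; exact ⟨hty, hI, hW, hlast, hC⟩
        · obtain ⟨t, ht, rfl⟩ := Finset.mem_image.1 hs
          obtain ⟨htT, hty⟩ := Finset.mem_filter.1 ht
          obtain ⟨-, -, hI, hW, hlast, hC⟩ := hend₂ t htT
          rw [hty] at hC; exact ⟨hty, hI, hW, hlast, hC⟩
        · -- a cross-grain pair of end states at `y`: non-co-axial, or priced by `hcross` (both stars are owned)
          obtain ⟨t, ht, rfl⟩ := Finset.mem_image.1 hs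
          obtain ⟨htT, hty⟩ := Finset.mem_filter.1 ht
          obtain ⟨-, -, hI, hW, hlast, hC⟩ := hend₁ t htT
          obtain ⟨t', ht', rfl⟩ := Finset.mem_image.1 hs'
          obtain ⟨htT', hty'⟩ := Finset.mem_filter.1 ht'
          obtain ⟨-, -, hI', hW', hlast', hC'⟩ := hend₂ t' htT'
          obtain ⟨e₀, rest₀, hse₀, hC₀⟩ := hC
          obtain ⟨e₀', rest₀', hse₀', hC₀'⟩ := hC'
          rw [hse] at hse₀; rw [hse'] at hse₀'
          injection hse₀ with he₀ _; injection hse₀' with he₀' _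
          subst he₀; subst he₀'; have hS₁ := hI.2.1; have hS₂ := hI'.2.1
          rcases hcross (f₁ t).2 (f₂ t').2 e e' rest rest' hS₁ hW hlast hse hS₂ hW' hlast' hse' with hnc | hpr
          · exact Or.inl hnc
          · right; have hyX : y ∈ X := by have := hI.1; rw [hty] at this; exact this
            rw [hse] at hS₁; rw [hse'] at hS₂
            rw [hty] at hC₀; rw [hty'] at hC₀'
            exact hpr X hX y hyX (star_owned_of_walkCertified hS₁.top.1 hC₀.walkCertified)
              (star_owned_of_walkCertified hS₂.top.1 hC₀'.walkCertified)
      have hsum₁ : T₁.card = ∑ y ∈ PAY, (T₁.filter fun t => (f₁ t).1 = y).card := Finset.card_eq_sum_card_fiberwise fun t ht => (hend₁ t ht).1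
      have hsum₂ : T₂.card = ∑ y ∈ PAY, (T₂.filter fun t => (f₂ t).1 = y).card := Finset.card_eq_sum_card_fiberwise fun t ht => (hend₂ t ht).1
      have hcount : (T₁.card : ℝ) + T₂.card ≤ ∑ y ∈ PAY, ((12 : ℝ) - ((X.filter fun q => dist y q = 1).card : ℝ)) := by
        rw [hsum₁, hsum₂]; push_cast; rw [← Finset.sum_add_distrib]
        refine Finset.sum_le_sum fun y hy => ?_; have := hpt y hy
        have h' : (deg y : ℝ) + ((T₁.filter fun t => (f₁ t).1 = y).card : ℝ) +
            ((T₂.filter fun t => (f₂ t).1 = y).card : ℝ) ≤ 12 := by exact_mod_cast this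
        simp only [hdeg] at h'; linarith
      linarith only [hcount, hT₁'', hT₂'']
    · -- SMALL CELL: the flux is within the error
      push Not at hbig; have hsmall : (κ₁ + κ₂) * Real.pi * ρ ^ 2 ≤ 2 * 2000 * (1 + h) * ρ := by
        have h1 : (κ₁ + κ₂) * Real.pi ≤ 16 := by nlinarith only [hκ₁0, hκ₂0, hκ₁2, hκ₂2, hπ, hπ0]
        have h2 : (κ₁ + κ₂) * Real.pi * ρ ^ 2 ≤ 16 * ρ ^ 2 := mul_le_mul_of_nonneg_right h1 (sq_nonneg ρ)
        have h3 : ρ ^ 2 ≤ ρ * (11 + L) := by rw [sq]; exact mul_le_mul_of_nonneg_left hbig.le hρ0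
        have hhρ : 0 ≤ h * ρ := mul_nonneg hh hρ0
        rw [hL] at h3; linarith only [h2, h3, hρ0, hhρ]
      linarith only [hsmall, hPAY0]
  have hD₁ := hC₁ (-(2 * 10)) (-10) (by ring) ρ hρ P₁ hP₁; have hD₂ := hC₂ (h + 10) (h + 2 * 10) (by ring) ρ hρ P₂ hP₂
  have hsplit₁ := contactDeficiency_sdiff_split hP₁X; have hsplit₂ := contactDeficiency_sdiff_split hP₂X
  have htwo := two_mul_contactDeficiency_eq_sum X; have hhρ : 0 ≤ h * ρ := mul_nonneg hh hρ0
  have hb : C₁ * ρ ≤ |C₁| * (1 + h) * ρ := by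
    have h1 : 0 ≤ (|C₁| - C₁) * ρ := mul_nonneg (by linarith only [le_abs_self C₁]) hρ0
    have h2 : 0 ≤ |C₁| * h * ρ := by positivity
    linarith only [h1, h2]
  have hc' : C₁ * ρ ≤ |C₁| * (1 + h) * ρ := by
    have h1 : 0 ≤ (|C₁| - C₁) * ρ := mul_nonneg (by linarith only [le_abs_self C₁]) hρ0
    have h2 : 0 ≤ |C₁| * h * ρ := by positivity
    linarith only [h1, h2]
  set SP : ℝ := ∑ y ∈ PAY, ((12 : ℝ) - ((X.filter fun q => dist y q = 1).card : ℝ)) with hSP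
  set C₀ : ℝ := 240 * Real.sqrt 2 * Real.pi + 4440 * (4 * 10 + 2) with hC₀
  have hDX : φ₁ * Real.pi * ρ ^ 2 + φ₂ * Real.pi * ρ ^ 2 + SP / 2 - C₀ * (1 + h) * ρ / 2 ≤ contactDeficiency X := by linarith only [hled, htwo]
  have hcross : ((((P₁ ×ˢ (X \ P₁)).filter fun pq => dist pq.1 pq.2 = 1).card : ℕ) : ℝ) +
      ((((P₂ ×ˢ ((X \ P₁) \ P₂)).filter fun pq => dist pq.1 pq.2 = 1).card : ℕ) : ℝ) =
      contactDeficiency P₁ + contactDeficiency P₂ + contactDeficiency ((X \ P₁) \ P₂) - contactDeficiency X := by linarith only [hsplit₁, hsplit₂]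
  rw [hcross]
  have hSP : (κ₁ + κ₂) * Real.pi * ρ ^ 2 / 2 - 2000 * (1 + h) * ρ ≤ SP / 2 := by linarith only [hmain]
  have hC₀0 : 0 ≤ C₀ * (1 + h) * ρ := by positivity
  nlinarith only [hDX, hSP, hD₁, hD₂, hb, hc', hC₀0, hρ0, hh, hhρ]

end Summit.Ventures.Crystal3D.Theorems

end
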